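import Literature.AnabelianGeometry.EtaleTheta.Discharge.Sec4NonVacuityTower
import Literature.AnabelianGeometry.EtaleTheta.SettingModelChiGroupLevelHolds
import Literature.AnabelianGeometry.EtaleTheta.SettingModelChiCoverings
import HarnessLib

/-!
# [EtTh] §4 over the GENUINE Kummer tower: the setting — `Π^tp_X ↠ ℤ ↠ ℤ/N = Aut(X_N)`, `A_⊙`, constants,
# `μ_N`-saturation (consistency witness, part 10b — data)

S. Mochizuki, *The étale theta function and its Frobenioid-theoretic manifestations*, Publ. RIMS **45**
(2009) [MochizukiEtTh2009], §4: setting of Def 4.1 (PDF p.86) — "`A_⊙^bs` is a Galois object",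
"`Π^tp_X ↠ Aut_D(A^bs)`" (Def 4.1 (ii) p.87), "`μ_N`-saturated" ([FrdII] Def 2.1 (i)).

CONSISTENCY WITNESS, TOY — sequel of `Sec4NonVacuityTower.lean` (part 10: the tower `Base` of covers `X_N` of
`𝔾_m/ℂ` with deck transformations, `Φ = ℚ_{≥0}`, `B = ℂˣ × t^ℤ` with the honest twisted pull-back, the tempered
Frobenioid `ToyTower.temperedFrobenioid`).  This file supplies the §4 SETTING over it:
* `Π^tp_X ↠ G_K` := abc-iut-L3's [SemiAnbd] Ex. 3.10 datum of the R78 χ-twisted root model of [EtTh] §1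
  (`Π = Γ ⋊_χ G_{ℚ_p}`, `Γ = F̂₂ ×_Ẑ ℤ`: tempered, SLIM, Galois-countable — all PROVED there,
  `SettingModel.nonempty_groupLevelData_curveχ_holds`, abc-iut-w5-d111 / w5-d249 / L6-d6 lineages), and
  **`Π^tp_X ↠ Aut_D(X_N) = ℤ/N`** := its loop quotient `Π^tp_X ↠ ℤ` (`(SettingModel.chiTwistData p).toZ`, onto)
  followed by `ℤ ↠ ℤ/N` and the deck transformations — EVERY object Galois with a NON-TRIVIAL group that
  `Π^tp_X` hits (`galoisSurj_surjective`; contrast `ToyCov`: `Aut = 1`, `Π^tp` trivial over `ℚ̄`);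
* `A_⊙ := (X_1, 0)` (Frobenius-trivial), `(N,H)`-slot `True`, and the `BiKummerSetting` through abc-iut-L2-t9's
  `mkOfModelCanonical`;
* the Kummer cover `X_{N·M} → X_M` and the uniformiser `t_M` (for the sequel's "roots ONLY upstairs");
* the constants `c ∈ ℂˣ` as units `coefUnit` and **`O^×(A) = ℂˣ`, every object `μ_N`-saturated for every `N`**
  (REAL [FrdII] Def 2.1 (i): `μ_N(A)` is cyclic of order `N`, generated by `exp(2πi/N)`).
HONEST LIMITS as in part 10 (toy: `𝔾_m`, not a Tate curve; trivial [FrdI] vocabularies; `(N,H)`-slot `True`;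
the Galois datum is borrowed from the §1 root model and acts only through `Π^tp_X ↠ ℤ`); consistency ≠
faithfulness; typed ≠ proved.  DATA file (`def`s are objects; no `Prop`-valued definition, no named fact, no
instance).  Nothing here bears on, or takes a side on, [IUTchIII] Cor. 3.12.
-/

noncomputable section

namespace Literature.AnabelianGeometry.EtaleTheta

open CategoryTheory Opposite Literature.AlgebraicGeometry.Frobenioids
open scoped NNRat

namespace ToyTower

open Base

/-! ## The Kummer cover `X_{N·M} → X_M` and the uniformiser `t_M` -/

/-- The object `X_{N·M}`. [cite: MochizukiEtTh2009, Prop 4.2 p.89] -/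
def coverObj (A : Base) (N : ℕ+) : Base := ⟨N * A.lvl⟩

/-- The canonical projection `X_{N·M} → X_M`, `t_M = t_{NM}^N` (shift `0`, degree `N`). [cite: MochizukiEtTh2009, Prop 4.2 p.89] -/
def cover (A : Base) (N : ℕ+) : coverObj A N ⟶ A := ⟨0, Dvd.intro_left _ (PNat.mul_coe N A.lvl).symm⟩

/-- The uniformiser `t_M = 1 · t_M^1 ∈ B(X_M)` (divisor `[0]`). [cite: MochizukiEtTh2009, Def 3.6 p.77] -/
def unif (A : Base) : temperedFrobenioid.ratFnFunctor.obj (op A) :=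
  ⟨((((1 : ℂˣ), Multiplicative.ofAdd (1 : ℤ)) : Fn),
    Algebra.GrothendieckGroup.of (⟨Multiplicative.ofAdd (1 : ℚ≥0), trivial⟩ : temperedFrobenioid.Φ.carrier (op A))), by
    change Toy.divHomQ (Multiplicative.ofAdd 1) = gpMap _ (Algebra.GrothendieckGroup.of _)
    rw [Toy.divHomQ_ofAdd_one, gpMap_of]
    rfl⟩

/-! ## The §4 setting over the tower: `Π^tp_X ↠ ℤ ↠ ℤ/N = Aut(X_N)` -/

section Galois

variable (p : ℕ) [Fact p.Prime]

/-- `Π^tp_X ↠ G_K` of the tower setting: the [SemiAnbd] Ex. 3.10 datum of the R78 χ-twisted root model of [EtTh] §1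
(`Π := Γ ⋊_χ G_{ℚ_p}`; slim, tempered, Galois-countable — `nonempty_groupLevelData_curveχ_holds`).
[cite: MochizukiEtTh2009, Def 4.1 p.86] -/
def temperedGroup : SemiGraphs.TemperedArithmeticGroup (SettingModel.curveχ p).K :=
  (SettingModel.curveχ p).toTemperedArithmeticGroup (SettingModel.nonempty_groupLevelData_curveχ_holds p).some

/-- The surjection `Π^tp_X ↠ Z = ℤ` of the root model ([EtTh] p.12), on the tower setting's `Π`. [cite: MochizukiEtTh2009, §1 p.12] -/
def toZ : (temperedGroup p).Pi →* Multiplicative ℤ := (SettingModel.chiTwistData p).toZ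

/-- `Π^tp_X ↠ ℤ` is onto. [cite: MochizukiEtTh2009, §1 p.12] -/
theorem toZ_surjective : Function.Surjective (toZ p) := (SettingModel.chiTwistData p).toZ_surjective

/-- `ℤ ↠ ℤ/N`, multiplicatively. [folklore] -/
def toZMod (A : Base) : Multiplicative ℤ →* Multiplicative (ZMod A.lvl) :=
  AddMonoidHom.toMultiplicative (Int.castAddHom (ZMod A.lvl))

/-- **`Π^tp_X ↠ Aut_D(X_N) = ℤ/N`**: `Π^tp_X ↠ ℤ ↠ ℤ/N` followed by the deck transformations (the `True`
argument is the Galois-object slot of `mkOfModelCanonical`: every `X_N` is Galois). [cite: MochizukiEtTh2009, Def 4.1 p.86] -/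
def galoisSurj (A : Base) (_h : True) : (temperedGroup p).Pi →* Aut A := (shiftHom A).comp ((toZMod A).comp (toZ p))

/-- The shift of `galoisSurj g` is `toZ g mod N`. [cite: MochizukiEtTh2009, Def 4.1 p.86] -/
theorem galoisSurj_apply_hom_shift (A : Base) (g : (temperedGroup p).Pi) :
    ((galoisSurj p A trivial g).hom).shift = ((Multiplicative.toAdd (toZ p g) : ℤ) : ZMod A.lvl) := rfl

/-- **`Π^tp_X ↠ Aut_D(X_N)` is surjective**: every object of the tower is Galois with group `ℤ/N`.
[cite: MochizukiEtTh2009, Def 4.1 p.86] -/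
theorem galoisSurj_surjective (A : Base) (h : True) : Function.Surjective (galoisSurj p A h) := by
  intro σ
  obtain ⟨z, hz⟩ := ZMod.intCast_surjective σ.hom.shift
  obtain ⟨g, hg⟩ := toZ_surjective p (Multiplicative.ofAdd z)
  refine ⟨g, ?_⟩
  rw [eq_shiftIso σ]
  apply Iso.ext
  apply hom_ext
  change ((Multiplicative.toAdd (toZ p g) : ℤ) : ZMod A.lvl) = σ.hom.shift
  rw [hg, toAdd_ofAdd, hz]

end Galois

/-- `A_⊙ := (X_1, 0)`. [cite: MochizukiEtTh2009, Def 4.1 p.86] -/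
def Aodot : temperedFrobenioid.category := ModelFrobenioid.zeroObj _ _ _ ⟨1⟩

/-- `A_⊙` is Frobenius-trivial. [cite: MochizukiEtTh2009, Def 4.1 p.86] -/
theorem isFrobeniusTrivial_Aodot : PreFrobenioid.IsFrobeniusTrivial temperedFrobenioid.toElem Aodot :=
  ModelFrobenioid.isFrobeniusTrivial_zeroObj ratFnFunctor_isGroupLike _

/-- **The §4 setting over the GENUINE Kummer tower**: the `BiKummerSetting` through abc-iut-L2-t9's
`mkOfModelCanonical` — Galois objects := all (`Aut(X_N) = ℤ/N`, `Π^tp_X ↠ ℤ ↠ ℤ/N` surjective),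
`(N,H)`-slot := `True`, `A_⊙ := (X_1, 0)`. [cite: MochizukiEtTh2009, Def 4.1 p.86] -/
def biKummerSetting (p : ℕ) [Fact p.Prime] : BiKummerSetting (temperedGroup p) realified Base catVocab :=
  BiKummerSetting.mkOfModelCanonical (temperedGroup p) temperedFrobenioid temperedFrobenioid_monoidType
    temperedFrobenioid_isPerfect (fun _ => True) (galoisSurj p) (galoisSurj_surjective p) (fun _ _ _ => True)
    Aodot isFrobeniusTrivial_Aodot trivial

/-! ## The constants `ℂˣ` as units -/

section Units

variable (A : temperedFrobenioid.category)

/-- The constant `c ∈ ℂˣ` as a function on `A^bs` (divisor `0`). [cite: MochizukiEtTh2009, Def 3.6 p.77] -/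
def cnst (c : ℂˣ) : temperedFrobenioid.ratFnFunctor.obj (op A.base) :=
  ⟨(((c, 1) : Fn), 1), by
    change Toy.divHomQ 1 = temperedFrobenioid.ΦgpToRlog _ 1
    exact (map_one _).trans (map_one _).symm⟩

/-- The constants as a homomorphism `ℂˣ → B(A^bs)^×`. [cite: MochizukiEtTh2009, Def 3.6 p.77] -/
def cnstUnitHom : ℂˣ →* (temperedFrobenioid.ratFnFunctor.obj (op A.base))ˣ where
  toFun c := ⟨cnst A c, cnst A c⁻¹, Subtype.ext (Prod.ext (Prod.ext (mul_inv_cancel c) (mul_one _)) (mul_one _)),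
    Subtype.ext (Prod.ext (Prod.ext (inv_mul_cancel c) (mul_one _)) (mul_one _))⟩
  map_one' := Units.ext (Subtype.ext rfl)
  map_mul' _ _ := Units.ext (Subtype.ext (Prod.ext (Prod.ext rfl (mul_one _).symm) (mul_one _).symm))

/-- `0 = Div_B(c)` for a constant. [cite: MochizukiFrdI2008, Thm. 5.2(i) p.100] -/
theorem of_one_eq_divB_cnst (c : ℂˣ) :
    Algebra.GrothendieckGroup.of (1 : temperedFrobenioid.divisorMonoid.obj (op A.base)) =
      divB temperedFrobenioid.divisorMonoid temperedFrobenioid.ratFnFunctor temperedFrobenioid.divBNatTrans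
        (op A.base) (cnst A c) := by
  rw [map_one]
  rfl

/-- "Multiplication by the constant `c`": the unit `(1, id, 0, c) ∈ O^×(A)`. [cite: MochizukiFrdI2008, Thm. 5.2(ii) p.101] -/
def coefAut (c : ℂˣ) : Aut A :=
  ModelFrobenioid.unitAut A 1 1 (cnst A c) (cnst A c⁻¹) (of_one_eq_divB_cnst A c) (of_one_eq_divB_cnst A c⁻¹)
    (one_mul 1) (Subtype.ext (Prod.ext (Prod.ext (inv_mul_cancel c) (mul_one _)) (mul_one _)))

/-- `coefAut c ∈ O^×(A)`. [cite: MochizukiFrdI2008, Thm. 5.2(ii) p.101] -/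
theorem coefAut_mem_units (c : ℂˣ) : coefAut A c ∈ ModelFrobenioid.units A :=
  ModelFrobenioid.unitAut_mem_units _ _ _ _ _ _ _ _ _

/-- `coefAut c` as an element of `O^×(A)`. [cite: MochizukiFrdI2008, Thm. 5.2(ii) p.101] -/
def coefUnit (c : ℂˣ) : ModelFrobenioid.units A := ⟨coefAut A c, coefAut_mem_units A c⟩

/-- `cnstUnitHom` is injective. [cite: MochizukiFrdI2008, Thm. 5.2(ii) p.101] -/
theorem cnstUnitHom_injective : Function.Injective (cnstUnitHom A) := fun _ _ h =>
  congrArg (fun u : (temperedFrobenioid.ratFnFunctor.obj (op A.base))ˣ =>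
    (u : temperedFrobenioid.ratFnFunctor.obj (op A.base)).1.1.1) h

/-- Under `O^×(A) ↪ B(A^bs)^×` ([FrdI] Thm 5.2 (ii)) `coefAut c ↦ c`. [cite: MochizukiFrdI2008, Thm. 5.2(ii) p.101] -/
theorem unitsToRatFn_coefUnit (c : ℂˣ) : ModelFrobenioid.unitsToRatFn A (coefUnit A c) = cnstUnitHom A c :=
  Units.ext rfl

/-- `Φ = ℚ_{≥0}` is objectwise divisorial (monoprime). [cite: MochizukiEtTh2009, Def 3.6 p.77] -/
theorem divisorMonoid_isDivisorial : Objectwise (fun M _ => IsDivisorial M) temperedFrobenioid.divisorMonoid :=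
  fun _ => (Toy.isMonoprime_of_eq_top_nnrat (S := (⊤ : Submonoid (Multiplicative ℚ≥0))) rfl).isDivisorial

/-- **`O^×(A) = ℂˣ`**: every unit of `A` is multiplication by a constant (`Div_B(u) = 0`, so the monomial part
is `0`) — in particular the deck transformations, which move `t_N`, are NOT units. [cite: MochizukiFrdI2008, Thm. 5.2(ii) p.101] -/
theorem exists_eq_cnstUnitHom (τ : ModelFrobenioid.units A) :
    ∃ c : ℂˣ, ModelFrobenioid.unitsToRatFn A τ = cnstUnitHom A c := by
  have h2 : (ModelFrobenioid.unitsToRatFn A τ : temperedFrobenioid.ratFnFunctor.obj (op A.base)).1.2 = 1 :=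
    ModelFrobenioid.divB_unitsToRatFn_eq_one (divisorMonoid_isDivisorial A.base).isSharp τ
  have h12 : (ModelFrobenioid.unitsToRatFn A τ : temperedFrobenioid.ratFnFunctor.obj (op A.base)).1.1.2 = 1 := by
    have hrel := (ModelFrobenioid.unitsToRatFn A τ : temperedFrobenioid.ratFnFunctor.obj (op A.base)).2
    change Toy.divHomQ _ = temperedFrobenioid.ΦgpToRlog _ _ at hrel
    rw [h2, map_one] at hrel
    exact Toy.divHomQ_injective (hrel.trans (map_one Toy.divHomQ).symm)
  exact ⟨(ModelFrobenioid.unitsToRatFn A τ : temperedFrobenioid.ratFnFunctor.obj (op A.base)).1.1.1,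
    Units.ext (Subtype.ext (Prod.ext (Prod.ext rfl h12) h2))⟩

/-- `O^×(A) ↪ B(A^bs)^×` is injective (`Φ` integral). [cite: MochizukiFrdI2008, Thm. 5.2(ii) p.101] -/
private theorem unitsToRatFn_injective' : Function.Injective (ModelFrobenioid.unitsToRatFn A) :=
  ModelFrobenioid.unitsToRatFn_injective (divisorMonoid_isDivisorial A.base).isPreDivisorial.isIntegral

/-- **Every object of the tower Frobenioid is `μ_N`-saturated, for every `N`** ([FrdII] Def 2.1 (i)):
`μ_N(A) ⊆ O^×(A) = ℂˣ` is cyclic of order `N`, generated by `exp(2πi/N)`. [cite: MochizukiEtTh2009, Def 4.1 p.87] -/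
theorem isMuSaturated (N : ℕ+) : temperedFrobenioid.IsMuSaturated A N := by
  have hN : (N : ℕ) ≠ 0 := PNat.ne_zero N
  have hζ := Complex.isPrimitiveRoot_exp N hN
  have hζu : IsPrimitiveRoot (hζ.isUnit hN).unit N := hζ.isUnit_unit hN
  set ζu : ℂˣ := (hζ.isUnit hN).unit
  have hinj := unitsToRatFn_injective' A
  have hord : orderOf (coefUnit A ζu) = (N : ℕ) := by
    rw [← orderOf_injective _ hinj (coefUnit A ζu), unitsToRatFn_coefUnit,
      orderOf_injective _ (cnstUnitHom_injective A) ζu]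
    exact hζu.eq_orderOf.symm
  refine ⟨(coefUnit A ζu : Aut A), ⟨⟨(coefAut_mem_units A ζu).1, (coefAut_mem_units A ζu).2⟩, ?_⟩, ?_, ?_⟩
  · have h := congrArg Subtype.val (pow_orderOf_eq_one (coefUnit A ζu))
    rwa [hord, SubmonoidClass.coe_pow] at h
  · rw [show (coefUnit A ζu : Aut A) = ((coefUnit A ζu : ModelFrobenioid.units A) : Aut A) from rfl,
      Subgroup.orderOf_coe, hord]
  · rintro τ ⟨hτu, hτN⟩
    let τu : ModelFrobenioid.units A := ⟨τ, hτu.1, hτu.2⟩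
    obtain ⟨c, hc⟩ := exists_eq_cnstUnitHom A τu
    have hτuN : τu ^ (N : ℕ) = 1 := Subtype.ext (by rw [SubmonoidClass.coe_pow]; exact hτN)
    have hcN : c ^ (N : ℕ) = 1 := cnstUnitHom_injective A (by
      rw [map_pow, ← hc, ← map_pow, hτuN, map_one, map_one])
    have hcmem : c ∈ Subgroup.zpowers ζu := by
      rw [hζu.zpowers_eq]
      exact (mem_rootsOfUnity _ c).2 hcN
    obtain ⟨i, hi⟩ := Subgroup.mem_zpowers_iff.mp hcmem
    have hτu' : (coefUnit A ζu) ^ i = τu :=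
      hinj (by rw [map_zpow, unitsToRatFn_coefUnit, ← map_zpow, hi, hc])
    exact Subgroup.mem_zpowers_iff.mpr ⟨i, by
      have h := congrArg Subtype.val hτu'
      rwa [SubgroupClass.coe_zpow] at h⟩

end Units

/-- **The §4 setting over the genuine Kummer tower is inhabited, with REAL `μ_N`-saturation and NON-TRIVIAL
Galois groups `Aut_D(X_N) ≅ ℤ/N` hit by `Π^tp_X`.** [cite: MochizukiEtTh2009, Def 4.1 p.87] -/
theorem nonempty_biKummerSetting_tower (p : ℕ) [Fact p.Prime] :
    ∃ S : BiKummerSetting (temperedGroup p) realified Base catVocab,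
      (∀ (A : S.C) (N : ℕ+), S.IsMuSaturated A N) ∧
      ∀ A : Base, Function.Surjective (galoisSurj p A trivial) ∧ Nonempty (Aut A ≃ ZMod A.lvl) :=
  ⟨biKummerSetting p, fun A N => isMuSaturated A N, fun A => ⟨galoisSurj_surjective p A trivial,
    ⟨(Equiv.ofBijective (fun a : ZMod A.lvl => shiftIso A a)
      ⟨fun _ _ h => (congrArg (fun σ : Aut A => σ.hom.shift) h :),
        fun σ => ⟨σ.hom.shift, (eq_shiftIso σ).symm⟩⟩).symm⟩⟩⟩

end ToyTower

end Literature.AnabelianGeometry.EtaleTheta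

end
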